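import Literature.NumberTheory.Sieve.BombieriFriedlanderIwaniecDispersionB
import Literature.NumberTheory.Sieve.BombieriFriedlanderIwaniecDispersionSeparation
import Literature.NumberTheory.Sieve.BombieriFriedlanderIwaniecTheorem1R1
import HarnessLib

/-!
# Bombieri–Friedlander–Iwaniec 1986, §9: `ℛ₁` in the `(q₀, q₁', q₂')` coordinates, Möbius inversion and the change of variable `r ↦ k`

Topic `Literature/NumberTheory/Sieve`.  Third file of the formalisation of the provable part of
§9 ("Estimation of `ℛ₁`. Second method", pp. 227–230) of E. Bombieri, J. B. Friedlander,
H. Iwaniec, *Primes in arithmetic progressions to large moduli*, Acta Math. 156 (1986), 203–251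
(toward **Theorem 2**, the named fact `Literature.NumberTheory.Sieve.BombieriFriedlanderIwaniecTheorem2`
of `…Dispersion`), after `…DispersionSeparation` and `…DispersionB`.

The remainder `ℛ₁` of (6.14) is already in the tree: `BFI.calR1` of `…DispersionS1` (derived there
from `𝒮₁`, in the original coordinates `q₁, q₂ ∼ Q`, both signs of `h`), with
`ℛ₁ = ℛ₁⁺ + conj ℛ₁⁺`, `ℛ₁⁺ = ∑_{q₀ ≤ Q₀} ℛ₁⁺(q₀)` (`BFI.calR1plus`, `BFI.calR1q` of `…Theorem1R1`).
This file (i) writes `ℛ₁⁺(q₀)` in the coordinates `q' = q₀q₁, q'' = q₀q₂, (q₁,q₂) = 1` of §6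
(`BFI.dispR1q0`, `BFI.dispR1C`) and PROVES the identification **`BFI.calR1q_eq_dispR1q0`**:
`calR1q a … H q₀ = dispR1q0 (−a) … H … q₀` (the phase `e(+hμ/L)` of the tree's Fourier convention is
the printed phase with `a ↦ −a`), hence `calR1plus a = dispR1C (−a)` and `‖calR1 a‖ ≤ 2‖dispR1C (−a)‖`;
and (ii) PROVES the first two steps of §9 on `dispR1q0`: the Möbius inversion of `(r, a) = 1`
((9.2)) and the change of variable `r ↦ k = (n₂ − n₁)/(q₀r)` ((9.3)–(9.6)), ending with the exact
identity `ℛ₁⁺(q₀) = ∑_{δ ∣ a} μ(δ) (Core₊(δ) + Core₋(δ))`.  Everything here is PROVED; no named facts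
are introduced.

## Contents

* Small lemmas: `BFI.e_eq_of_sub_int`, `BFI.klNum_neg_add_dvd`, **`BFI.e_klNum_sign`**
  (`e(ρ_a h(σk)/c) = e(ρ_{σa} h k/c)`, `σ = ±1`), `BFI.coprime_of_cop`, `BFI.coprime_of_dvd_sub`
  (the coprimality `(δq₀k, n₁n₂) = 1` of (9.4) is automatic), `BFI.char_inv_eq_conj_of_isUnit`,
  **`BFI.sum_conj_char_mul_char`** (orthogonality modulo `q`, conjugate form).
* `BFI.qSet Q q₀ = {q ≥ 1 : q₀q ∼ Q}`, `BFI.qSet_bounds`; `BFI.hTerm`, **`BFI.dispR1q0`**, **`BFI.dispR1C`**.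
* `BFI.CoreCond`, `BFI.KCond`, `BFI.coreTerm`, **`BFI.coreSum`** (`Core_σ(δ; 𝒦)`), `BFI.rTerm`;
  `BFI.hTerm_sum_eq_coreTerm`, `BFI.sum_r_graph_eq`, `BFI.indicator_dvd_eq_sum_k`,
  `BFI.sum_r_eq_sum_k`, `BFI.natAbs_le_floor_of_rel` ((9.6)), `BFI.ne_of_cop`,
  `BFI.sum_r_nn_eq_sum_k`, `BFI.isCoprime_natCast_iff`, and **`BFI.dispR1q0_eq_sum_moebius`**.
* The bridge to `…DispersionS1`/`…Theorem1R1`: `BFI.coprime_parts_of_cop`, **`BFI.calR1_conds_iff`**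
  (`(q₀q,q₀q') = q₀ ∧ Main ∧ Solvable ↔ ((q,q')=1 ∧ (q₀qq'r,−a)=1) ∧ ((n₁q',n₂q)=1 ∧ q₀r ∣ n₂−n₁)`),
  `BFI.lmod_mul_mul_eq`, **`BFI.e_bfiPhase_eq_klNum`**, `BFI.calR1_term_eq`,
  `BFI.calR1q_term_eq_zero_of_not_dvd`, **`BFI.calR1q_eq_dispR1q0`**, **`BFI.calR1plus_eq_dispR1C`**,
  **`BFI.norm_calR1_le_two_mul_dispR1C`**.

## Faithfulness

* `dispR1q0`/`dispR1C` transcribe (6.14) in the §6 coordinates: `r ∼ R`; `q₀ ≤ Q₀`; `q₁, q₂` with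
  `q₀qᵢ ∼ Q`, `(q₁,q₂) = 1`, `(a, q₀q₁q₂r) = 1`; `n₁, n₂ ∼ N` with `(n₁q₂, n₂q₁) = 1`,
  `n₁ ≡ n₂ (q₀r)`; coefficient `γ_{q₀q₁}γ_{q₀q₂}/(q₀q₁q₂r) β_{n₁}β_{n₂}`; `1 ≤ h ≤ H`; the term
  `𝓕f(h/(q₀q₁q₂r)) e(h k ρ/(n₁q₂))`, `ρ = a(n₂q₁)‾ (mod n₁q₂)`, Mathlib's `𝓕`.  By `calR1q_eq_dispR1q0`
  this IS the tree's `ℛ₁⁺(q₀)` (conditions `Main ∧ Solvable` ↔ the printed coprimality conditions,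
  `L = q₀q₁q₂r`, phases equal after `a ↦ −a`), so bounds proved for `dispR1C` (all `a ≠ 0`) are bounds
  for `BFI.calR1`.  The squarefree factor `μ²(n₁n₂)` of (6.14) is left to the coefficients.
* (9.2)–(9.6) as printed; the sign of `k` is carried by `σ` and moved into `a` (`e_klNum_sign`).

## References

* E. Bombieri, J. B. Friedlander, H. Iwaniec, Acta Math. 156 (1986), 203–251, §6 (6.14) p. 221,
  §9 (9.1)–(9.6) pp. 227–228. [BombieriFriedlanderIwaniecActa1986]
-/

noncomputable section

open Finset Real MeasureTheory Complex
open scoped FourierTransform ArithmeticFunction.sigma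

namespace Literature.NumberTheory.Sieve

namespace BFI

/-! ### Small lemmas on `e(·)`, `klNum` and coprimality -/

/-- `e(x) = e(y)` when `x − y ∈ ℤ`. [folklore] -/
theorem e_eq_of_sub_int {x y : ℝ} (n : ℤ) (h : x - y = n) : (𝐞 x : ℂ) = (𝐞 y : ℂ) := by
  rw [show x = y + n by linarith, AddChar.map_add_eq_mul, Circle.coe_mul, RamanujanSum.fourierChar_intCast,
    mul_one]

/-- `klNum (−a) ≡ −klNum a (mod c)`. [folklore] -/
theorem klNum_neg_add_dvd (a : ℤ) {c : ℕ} (hc : 0 < c) (nd : ℕ) :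
    (c : ℤ) ∣ (klNum (-a) c nd : ℤ) + (klNum a c nd : ℤ) := by
  haveI : NeZero c := ⟨hc.ne'⟩
  rw [← ZMod.intCast_zmod_eq_zero_iff_dvd]
  push_cast
  unfold klNum
  rw [ZMod.natCast_zmod_val, ZMod.natCast_zmod_val]
  push_cast
  ring

/-- **Sign flip in the Kloosterman phase**: `e(ρ_a h (±k)/c) = e(ρ_{±a} h k/c)`.
[folklore] -/
theorem e_klNum_sign {sg : ℤ} (hsg : sg = 1 ∨ sg = -1) (a : ℤ) (c nd : ℕ) (h k : ℤ) :
    (𝐞 ((klNum a c nd : ℝ) * h * (sg * k) / c) : ℂ) =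
      (𝐞 ((klNum (sg * a) c nd : ℝ) * h * k / c) : ℂ) := by
  rcases hsg with rfl | rfl
  · simp
  · rcases Nat.eq_zero_or_pos c with rfl | hc
    · simp
    have hc0 : (c : ℝ) ≠ 0 := by exact_mod_cast hc.ne'
    obtain ⟨t, ht⟩ := klNum_neg_add_dvd a hc nd
    simp only [neg_mul, one_mul, Int.cast_neg, Int.cast_one]
    refine e_eq_of_sub_int (-(t * h * k)) ?_
    have ht' : ((klNum (-a) c nd : ℕ) : ℝ) + (klNum a c nd : ℕ) = (c : ℝ) * t := by
      exact_mod_cast ht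
    field_simp
    push_cast
    linear_combination (-(h : ℝ) * k) * ht'

/-- From `(n₁ q₂, n₂ q₁) = 1`: `(n₁, n₂) = 1`. [folklore] -/
theorem coprime_of_cop {n₁ n₂ q₁ q₂ : ℕ} (h : (n₁ * q₂).Coprime (n₂ * q₁)) : n₁.Coprime n₂ :=
  (Nat.Coprime.coprime_mul_right h).coprime_mul_right_right

/-- If `(n₁, n₂) = 1` and `q ∣ n₂ − n₁` then `(n₁, q) = 1`. [folklore] -/
theorem coprime_of_dvd_sub {n₁ n₂ q : ℕ} (hcop : n₁.Coprime n₂) (hd : (q : ℤ) ∣ (n₂ : ℤ) - n₁) :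
    n₁.Coprime q := by
  rw [Nat.coprime_comm, Nat.Coprime, Nat.gcd_comm]
  by_contra hg
  obtain ⟨p, hp, hpdvd⟩ := Nat.exists_prime_and_dvd hg
  have hp1 : p ∣ n₁ := hpdvd.trans (Nat.gcd_dvd_left _ _)
  have hp2 : p ∣ q := hpdvd.trans (Nat.gcd_dvd_right _ _)
  have hp3 : (p : ℤ) ∣ (n₂ : ℤ) := by
    have h1 : (p : ℤ) ∣ (n₂ : ℤ) - n₁ := (Int.natCast_dvd_natCast.2 hp2).trans hd
    have h2 : (p : ℤ) ∣ (n₁ : ℤ) := Int.natCast_dvd_natCast.2 hp1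
    have := h1.add h2
    simpa using this
  have hp3' : p ∣ n₂ := Int.natCast_dvd_natCast.1 hp3
  exact hp.one_lt.ne' ((Nat.Coprime.coprime_dvd_left hp1 hcop).eq_one_of_dvd hp3')

/-- `χ(u⁻¹) = conj χ(u)` for a unit `u (mod q)`. [folklore] -/
theorem char_inv_eq_conj_of_isUnit {q : ℕ} [NeZero q] (χ : DirichletCharacter ℂ q) {x : ZMod q}
    (hx : IsUnit x) : χ x⁻¹ = starRingEnd ℂ (χ x) := by
  obtain ⟨u, rfl⟩ := hx
  rw [ZMod.inv_coe_unit]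
  have h1 : χ ((u⁻¹ : (ZMod q)ˣ) : ZMod q) * χ (u : ZMod q) = 1 := by
    rw [← map_mul, Units.inv_mul, map_one]
  have h2 : χ ((u⁻¹ : (ZMod q)ˣ) : ZMod q) = (χ (u : ZMod q))⁻¹ :=
    eq_inv_of_mul_eq_one_left h1
  rw [h2]
  exact Complex.inv_eq_conj (χ.unit_norm_eq_one u)

/-- **Orthogonality of the characters `(mod q)`**, in the form with complex conjugates:
`∑_χ conj(χ(n₁)) χ(n₂) = φ(q)` if `n₁` is a unit `(mod q)` congruent to `n₂`, and `0` otherwise.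
[folklore] -/
theorem sum_conj_char_mul_char {q : ℕ} [NeZero q] (n₁ n₂ : ℕ) :
    ∑ χ : DirichletCharacter ℂ q, starRingEnd ℂ (χ (n₁ : ZMod q)) * χ (n₂ : ZMod q) =
      if IsUnit (n₁ : ZMod q) ∧ (n₁ : ZMod q) = (n₂ : ZMod q) then (Nat.totient q : ℂ) else 0 := by
  by_cases hu : IsUnit (n₁ : ZMod q)
  · have h := DirichletCharacter.sum_char_inv_mul_char_eq ℂ hu (n₂ : ZMod q)
    simp only [hu, true_and]
    rw [← h]
    refine Finset.sum_congr rfl fun χ _ => ?_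
    rw [char_inv_eq_conj_of_isUnit χ hu]
  · rw [if_neg (fun h => hu h.1)]
    refine Finset.sum_eq_zero fun χ _ => ?_
    rw [MulChar.map_nonunit χ hu, map_zero, zero_mul]


/-! ### Ranges `q₀ q ∼ Q` -/

/-- The moduli `q ≥ 1` with `q₀ q ∼ Q` (so that `q' = q₀ q₁`, `q'' = q₀ q₂` in BFI §6, p. 220).
[cite: BombieriFriedlanderIwaniecActa1986, §6 p. 220] -/
def qSet (Q : ℝ) (q₀ : ℕ) : Finset ℕ := (Icc 1 ⌊2 * Q⌋₊).filter (fun q => q₀ * q ∈ dyadic Q)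

/-- Members of `qSet`: `q ≥ 1` and `Q/q₀ < q ≤ 2Q/q₀`. [folklore] -/
theorem qSet_bounds {Q : ℝ} (hQ : 0 ≤ Q) {q₀ q : ℕ} (hq₀ : 0 < q₀) (hq : q ∈ qSet Q q₀) :
    1 ≤ q ∧ Q / q₀ < q ∧ (q : ℝ) ≤ 2 * Q / q₀ := by
  unfold qSet at hq
  rw [Finset.mem_filter, Finset.mem_Icc] at hq
  have h := (mem_dyadic hQ).1 hq.2
  push_cast at h
  have hq0 : (0 : ℝ) < q₀ := by exact_mod_cast hq₀
  refine ⟨hq.1.1, ?_, ?_⟩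
  · rw [div_lt_iff₀ hq0]; linarith
  · rw [le_div_iff₀ hq0]; linarith

/-! ### `ℛ₁` (BFI (6.14)) with `1 ≤ h ≤ H` -/

/-- One `h`-term of (6.14): `𝓕f(h/D) · e(ρ h k / c)` with `ρ = a (n₂q₁)‾ (mod c)`, `c = n₁ q₂`,
`D = q₀ q₁ q₂ r`, `k = (n₂ − n₁)/(q₀ r)`. [cite: BombieriFriedlanderIwaniecActa1986, §6 (6.14) p. 221] -/
def hTerm (a : ℤ) (M Y : ℝ) (D c nd : ℕ) (k : ℤ) (h : ℕ) : ℂ :=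
  𝓕 (bumpC M Y) ((h : ℝ) / D) * (𝐞 ((klNum a c nd : ℝ) * h * k / c) : ℂ)

/-- **The `q₀`-slice of `ℛ₁`** (BFI (6.14), p. 221) with the `h`-sum over `1 ≤ h ≤ H` and the
weight `f = BFI.bump M Y` (Mathlib's `𝓕f(y) = ∫ f(x) e(−xy) dx`):
`∑_{r ∼ R} ∑_{(q₁,q₂)=1, (a, q₀q₁q₂r)=1, q₀qᵢ ∼ Q} γ_{q₀q₁} γ_{q₀q₂}/(q₀q₁q₂r)
  ∑_{nᵢ ∼ N, (n₁q₂, n₂q₁)=1, n₁ ≡ n₂ (q₀r)} β_{n₁} β_{n₂} ∑_{1 ≤ h ≤ H} 𝓕f(h/(q₀q₁q₂r)) e(ahk (n₂q₁)‾/(n₁q₂))`,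
`k = (n₂ − n₁)/(q₀r)`. [cite: BombieriFriedlanderIwaniecActa1986, §6 (6.14) p. 221] -/
def dispR1q0 (a : ℤ) (M Y N Q R H : ℝ) (β γ : ℕ → ℝ) (q₀ : ℕ) : ℂ :=
  ∑ r ∈ dyadic R, ∑ q₁ ∈ qSet Q q₀, ∑ q₂ ∈ qSet Q q₀,
    if q₁.Coprime q₂ ∧ IsCoprime ((q₀ * q₁ * q₂ * r : ℕ) : ℤ) a then
      ((γ (q₀ * q₁) * γ (q₀ * q₂) / ((q₀ * q₁ * q₂ * r : ℕ) : ℝ) : ℝ) : ℂ) *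
        ∑ n₁ ∈ dyadic N, ∑ n₂ ∈ dyadic N,
          if (n₁ * q₂).Coprime (n₂ * q₁) ∧ ((q₀ * r : ℕ) : ℤ) ∣ ((n₂ : ℤ) - n₁) then
            ((β n₁ * β n₂ : ℝ) : ℂ) * ∑ h ∈ Icc 1 ⌊H⌋₊,
              hTerm a M Y (q₀ * q₁ * q₂ * r) (n₁ * q₂) (n₂ * q₁) (((n₂ : ℤ) - n₁) / (q₀ * r)) h
          else 0
    else 0

/-- **`ℛ₁⁺`**: the sum `ℛ₁` of BFI (6.14) with `q₀ ≤ Q₀` and the `h`-sum restricted to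
`1 ≤ h ≤ H` (the terms `−H ≤ h ≤ −1` are the complex conjugates, `f, β, γ` being real).
[cite: BombieriFriedlanderIwaniecActa1986, §6 (6.14) p. 221] -/
def dispR1C (a : ℤ) (M Y N Q R Q₀ H : ℝ) (β γ : ℕ → ℝ) : ℂ :=
  ∑ q₀ ∈ Icc 1 ⌊Q₀⌋₊, dispR1q0 a M Y N Q R H β γ q₀

/-! ### The core sums of §9 (after Möbius inversion and the change of variable `r ↦ k`) -/

/-- The conditions (9.3)–(9.5) on `(n₁, n₂)` for given `k ≥ 1`, sign `σ = ±1`, `m = δq₀`: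
`(n₁q₂, n₂q₁) = 1`, `δq₀k ∣ n₂ − n₁`, and `R < σ(n₂ − n₁)/(q₀k) ≤ 2R` (i.e. `δr ∼ R` for
`r = σ(n₂−n₁)/(δq₀k)`). [cite: BombieriFriedlanderIwaniecActa1986, §9 (9.3)–(9.5) p. 228] -/
def CoreCond (sg : ℤ) (R : ℝ) (q₀ δ k q₁ q₂ n₁ n₂ : ℕ) : Prop :=
  (n₁ * q₂).Coprime (n₂ * q₁) ∧ ((δ * q₀ * k : ℕ) : ℤ) ∣ ((n₂ : ℤ) - n₁) ∧
    R < sg * ((n₂ : ℝ) - n₁) / (q₀ * k) ∧ sg * ((n₂ : ℝ) - n₁) / (q₀ * k) ≤ 2 * R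

/-- `CoreCond` is decidable. [folklore] -/
instance CoreCond.decidable (sg : ℤ) (R : ℝ) (q₀ δ k q₁ q₂ n₁ n₂ : ℕ) :
    Decidable (CoreCond sg R q₀ δ k q₁ q₂ n₁ n₂) := by
  unfold CoreCond; infer_instance

/-- The `(k, q₁, q₂, n₁, n₂)`-term of the core sum:
`(k/(q₁q₂σ(n₂−n₁))) ∑_{h ≤ H} 𝓕f(hk/(q₁q₂σ(n₂−n₁))) e(a' h k (n₂q₁)‾/(n₁q₂))`, `a' = σa`.
[cite: BombieriFriedlanderIwaniecActa1986, §9 (9.2) p. 228] -/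
def coreTerm (a sg : ℤ) (M Y H : ℝ) (k q₁ q₂ n₁ n₂ : ℕ) : ℂ :=
  (((k : ℝ) / (q₁ * q₂ * (sg * ((n₂ : ℝ) - n₁))) : ℝ) : ℂ) *
    ∑ h ∈ Icc 1 ⌊H⌋₊, 𝓕 (bumpC M Y) ((h : ℝ) * k / (q₁ * q₂ * (sg * ((n₂ : ℝ) - n₁)))) *
      (𝐞 ((klNum (sg * a) (n₁ * q₂) (n₂ * q₁) : ℝ) * h * k / (n₁ * q₂)) : ℂ)

/-- **The core sum** (BFI (9.2) after (9.3)–(9.6), p. 228) for the sign `σ`, the Möbius variable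
`δ` and a set `𝒦` of values of `k ≥ 1`:
`∑_{k ∈ 𝒦} ∑_{(q₁,q₂)=1, (a,q₀q₁q₂)=1} γ_{q₀q₁}γ_{q₀q₂} ∑_{(n₁,n₂) : (9.3)–(9.5)} β_{n₁}β_{n₂} · coreTerm`.
[cite: BombieriFriedlanderIwaniecActa1986, §9 (9.2)–(9.6) p. 228] -/
def coreSum (a sg : ℤ) (M Y N Q R H : ℝ) (β γ : ℕ → ℝ) (q₀ δ : ℕ) (Kset : Finset ℕ) : ℂ :=
  ∑ k ∈ Kset, ∑ q₁ ∈ qSet Q q₀, ∑ q₂ ∈ qSet Q q₀,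
    if q₁.Coprime q₂ ∧ (q₀ * q₁ * q₂).Coprime a.natAbs then
      ((γ (q₀ * q₁) * γ (q₀ * q₂) : ℝ) : ℂ) * ∑ n₁ ∈ dyadic N, ∑ n₂ ∈ dyadic N,
        if CoreCond sg R q₀ δ k q₁ q₂ n₁ n₂ then
          ((β n₁ * β n₂ : ℝ) : ℂ) * coreTerm a sg M Y H k q₁ q₂ n₁ n₂ else 0
    else 0

/-! ### The change of variable `r ↦ k = (n₂ − n₁)/(q₀ r)` -/

/-- **The term identity** behind (9.3): if `q₀ r k = σ (n₂ − n₁)` with `r ≥ 1` then the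
`(r, n₁, n₂)`-term of (6.14) is the `(k, n₁, n₂)`-term of the core sum.
[cite: BombieriFriedlanderIwaniecActa1986, §9 (9.3) p. 228] -/
theorem hTerm_sum_eq_coreTerm (a : ℤ) (M Y H : ℝ) {sg : ℤ} (hsg : sg = 1 ∨ sg = -1)
    {q₀ r k q₁ q₂ n₁ n₂ : ℕ} (hq₀ : 0 < q₀) (hr : 0 < r) (hk : 0 < k) (hq₁ : 0 < q₁) (hq₂ : 0 < q₂)
    (hrel : ((q₀ * r * k : ℕ) : ℤ) = sg * ((n₂ : ℤ) - n₁)) :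
    (((1 / ((q₀ * q₁ * q₂ * r : ℕ) : ℝ) : ℝ) : ℂ) * ∑ h ∈ Icc 1 ⌊H⌋₊,
        hTerm a M Y (q₀ * q₁ * q₂ * r) (n₁ * q₂) (n₂ * q₁) (((n₂ : ℤ) - n₁) / (q₀ * r)) h) =
      coreTerm a sg M Y H k q₁ q₂ n₁ n₂ := by
  have hsg2 : sg * sg = 1 := by rcases hsg with rfl | rfl <;> norm_num
  -- the integer `k' = (n₂ - n₁)/(q₀ r)` is `σ k`
  have hl : (n₂ : ℤ) - n₁ = (q₀ * r : ℕ) * (sg * k) := by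
    have := congrArg (fun z => sg * z) hrel
    simp only [← mul_assoc, hsg2, one_mul] at this
    rw [← this]; push_cast; ring
  have hq0r : ((q₀ * r : ℕ) : ℤ) ≠ 0 := by positivity
  have hdiv : ((n₂ : ℤ) - n₁) / (q₀ * r) = sg * k := by
    rw [hl]; push_cast
    rw [show (q₀ : ℤ) * r * (sg * k) = sg * k * (q₀ * r) by ring]
    exact Int.mul_ediv_cancel _ (by exact_mod_cast hq0r)
  -- the real number `q₀ q₁ q₂ r` is `q₁ q₂ σ(n₂ − n₁)/k`
  have hrelR : (q₀ : ℝ) * r * k = sg * ((n₂ : ℝ) - n₁) := by exact_mod_cast hrel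
  have hk0 : (k : ℝ) ≠ 0 := by exact_mod_cast hk.ne'
  have hq00 : (q₀ : ℝ) ≠ 0 := by exact_mod_cast hq₀.ne'
  have hr0 : (r : ℝ) ≠ 0 := by exact_mod_cast hr.ne'
  have hl0 : sg * ((n₂ : ℝ) - n₁) ≠ 0 := by rw [← hrelR]; positivity
  have hD : (q₁ : ℝ) * q₂ * (sg * ((n₂ : ℝ) - n₁)) = ((q₀ * q₁ * q₂ * r : ℕ) : ℝ) * k := by
    rw [← hrelR]; push_cast; ring
  unfold coreTerm hTerm
  congr 1
  · congr 1
    rw [hD]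
    field_simp
  · refine Finset.sum_congr rfl fun h _ => ?_
    congr 1
    · rw [hD]
      field_simp
    · rw [hdiv]
      have := e_klNum_sign hsg a (n₁ * q₂) (n₂ * q₁) h k
      push_cast at this ⊢
      exact this


/-- The `(r, n₁, n₂)`-term of (6.14) without the coefficients `γ γ β β`:
`Φ(r) = (q₀q₁q₂r)⁻¹ ∑_{h ≤ H} 𝓕f(h/(q₀q₁q₂r)) e(a h k' (n₂q₁)‾/(n₁q₂))`, `k' = (n₂ − n₁)/(q₀r)`. [folklore] -/
def rTerm (a : ℤ) (M Y H : ℝ) (q₀ q₁ q₂ n₁ n₂ r : ℕ) : ℂ :=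
  (((1 / ((q₀ * q₁ * q₂ * r : ℕ) : ℝ) : ℝ) : ℂ) * ∑ h ∈ Icc 1 ⌊H⌋₊,
    hTerm a M Y (q₀ * q₁ * q₂ * r) (n₁ * q₂) (n₂ * q₁) (((n₂ : ℤ) - n₁) / (q₀ * r)) h)

/-- The conditions of the core sum other than `(n₁q₂, n₂q₁) = 1`. [folklore] -/
def KCond (sg : ℤ) (R : ℝ) (q₀ δ k n₁ n₂ : ℕ) : Prop :=
  ((δ * q₀ * k : ℕ) : ℤ) ∣ ((n₂ : ℤ) - n₁) ∧
    R < sg * ((n₂ : ℝ) - n₁) / (q₀ * k) ∧ sg * ((n₂ : ℝ) - n₁) / (q₀ * k) ≤ 2 * R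

/-- `KCond` is decidable. [folklore] -/
instance KCond.decidable (sg : ℤ) (R : ℝ) (q₀ δ k n₁ n₂ : ℕ) :
    Decidable (KCond sg R q₀ δ k n₁ n₂) := by
  unfold KCond; infer_instance

/-- `CoreCond = (n₁q₂, n₂q₁) = 1 ∧ KCond`. [folklore] -/
theorem coreCond_iff (sg : ℤ) (R : ℝ) (q₀ δ k q₁ q₂ n₁ n₂ : ℕ) :
    CoreCond sg R q₀ δ k q₁ q₂ n₁ n₂ ↔ (n₁ * q₂).Coprime (n₂ * q₁) ∧ KCond sg R q₀ δ k n₁ n₂ :=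
  Iff.rfl

/-- **(E4)** For fixed `k ≥ 1` and sign `σ`: among `r ∼ R` with `δ ∣ r`, at most one has
`q₀ r k = σ(n₂ − n₁)`, namely `r = σ(n₂−n₁)/(q₀k)`, and it exists iff `KCond σ` holds; its term is
the core term. [cite: BombieriFriedlanderIwaniecActa1986, §9 (9.3)–(9.5) p. 228] -/
theorem sum_r_graph_eq (a : ℤ) (M Y H : ℝ) {R : ℝ} (hR : 0 ≤ R) {sg : ℤ} (hsg : sg = 1 ∨ sg = -1)
    {q₀ δ k q₁ q₂ : ℕ} (hq₀ : 0 < q₀) (hδ : 0 < δ) (hk : 0 < k) (hq₁ : 0 < q₁) (hq₂ : 0 < q₂)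
    (n₁ n₂ : ℕ) :
    ∑ r ∈ dyadic R,
        (if ((q₀ * r * k : ℕ) : ℤ) = sg * ((n₂ : ℤ) - n₁) ∧ δ ∣ r then
          rTerm a M Y H q₀ q₁ q₂ n₁ n₂ r else 0) =
      if KCond sg R q₀ δ k n₁ n₂ then coreTerm a sg M Y H k q₁ q₂ n₁ n₂ else 0 := by
  have hsg2 : sg * sg = 1 := by rcases hsg with rfl | rfl <;> norm_num
  have hq0k : (0 : ℝ) < q₀ * k := by positivity
  have hlR : (((n₂ : ℤ) - n₁ : ℤ) : ℝ) = (n₂ : ℝ) - n₁ := by push_cast; ring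
  -- a solution `r` forces `KCond` and is determined
  have hsol : ∀ r ∈ dyadic R, ((q₀ * r * k : ℕ) : ℤ) = sg * ((n₂ : ℤ) - n₁) → δ ∣ r →
      KCond sg R q₀ δ k n₁ n₂ ∧ (r : ℝ) = sg * ((n₂ : ℝ) - n₁) / (q₀ * k) := by
    intro r hr hrel hδr
    have hrR := (mem_dyadic hR).1 hr
    have hrel' : (q₀ : ℝ) * r * k = sg * ((n₂ : ℝ) - n₁) := by
      have := congrArg (fun z : ℤ => (z : ℝ)) hrel
      push_cast at this
      linarith
    have hreq : (r : ℝ) = sg * ((n₂ : ℝ) - n₁) / (q₀ * k) := by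
      rw [eq_div_iff hq0k.ne']; linarith
    refine ⟨⟨?_, ?_, ?_⟩, hreq⟩
    · obtain ⟨t, ht⟩ := hδr
      refine ⟨sg * t, ?_⟩
      have := congrArg (fun z => sg * z) hrel
      rw [← mul_assoc, hsg2, one_mul] at this
      rw [← this, ht]; push_cast; ring
    · rw [← hreq]; exact hrR.1
    · rw [← hreq]; exact hrR.2
  by_cases hK : KCond sg R q₀ δ k n₁ n₂
  · rw [if_pos hK]
    obtain ⟨⟨t, ht⟩, h1, h2⟩ := hK
    -- the solution `r₀ = σ δ t`
    have hpos : (0 : ℝ) < sg * ((n₂ : ℝ) - n₁) / (q₀ * k) := hR.trans_lt h1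
    have htR : (n₂ : ℝ) - n₁ = ((δ * q₀ * k : ℕ) : ℝ) * t := by
      have := congrArg (fun z : ℤ => (z : ℝ)) ht
      push_cast at this ⊢
      linarith
    have hval : sg * ((n₂ : ℝ) - n₁) / (q₀ * k) = ((sg * δ * t : ℤ) : ℝ) := by
      rw [htR]; push_cast; field_simp
    have hpos' : (0 : ℤ) < sg * δ * t := by
      have : (0 : ℝ) < ((sg * δ * t : ℤ) : ℝ) := by rw [← hval]; exact hpos
      exact_mod_cast this
    set r₀ : ℕ := (sg * δ * t).toNat with hr₀
    have hr₀Z : (r₀ : ℤ) = sg * δ * t := Int.toNat_of_nonneg hpos'.le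
    have hr₀R : (r₀ : ℝ) = sg * ((n₂ : ℝ) - n₁) / (q₀ * k) := by
      rw [hval]; exact_mod_cast hr₀Z
    have hr₀pos : 0 < r₀ := by
      have : (0 : ℤ) < r₀ := by rw [hr₀Z]; exact hpos'
      exact_mod_cast this
    have hr₀mem : r₀ ∈ dyadic R := by
      rw [mem_dyadic hR, hr₀R]; exact ⟨h1, h2⟩
    have hrel₀ : ((q₀ * r₀ * k : ℕ) : ℤ) = sg * ((n₂ : ℤ) - n₁) := by
      push_cast
      rw [hr₀Z, ht]; push_cast; ring
    have hδr₀ : δ ∣ r₀ := by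
      have : (δ : ℤ) ∣ (r₀ : ℤ) := ⟨sg * t, by rw [hr₀Z]; ring⟩
      exact_mod_cast this
    rw [Finset.sum_eq_single_of_mem r₀ hr₀mem]
    · rw [if_pos ⟨hrel₀, hδr₀⟩]
      exact hTerm_sum_eq_coreTerm a M Y H hsg hq₀ hr₀pos hk hq₁ hq₂ hrel₀
    · intro r hr hne
      rw [if_neg]
      rintro ⟨hrel, hδr⟩
      apply hne
      have h := (hsol r hr hrel hδr).2
      rw [← hr₀R] at h
      exact_mod_cast h
  · rw [if_neg hK]
    refine Finset.sum_eq_zero fun r hr => ?_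
    rw [if_neg]
    rintro ⟨hrel, hδr⟩
    exact hK (hsol r hr hrel hδr).1


/-- **(E3)** For fixed `r ∼ R` and `n₁ ≠ n₂`: `[δ ∣ r ∧ q₀ r ∣ n₂ − n₁]` equals the number of
`k ∈ [1, K]` and signs `σ` with `q₀ r k = σ(n₂ − n₁)` (there is at most one such pair, and
`|k| ≤ K` is guaranteed by the hypothesis `hK`). [cite: BombieriFriedlanderIwaniecActa1986, §9 (9.3), (9.6) p. 228] -/
theorem indicator_dvd_eq_sum_k {q₀ δ r : ℕ} (hq₀ : 0 < q₀) (hr : 0 < r) {n₁ n₂ : ℕ}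
    (hne : n₁ ≠ n₂) {Kmax : ℕ}
    (hK : ∀ κ : ℤ, ((q₀ * r : ℕ) : ℤ) * κ = (n₂ : ℤ) - n₁ → κ.natAbs ≤ Kmax) :
    (if δ ∣ r ∧ ((q₀ * r : ℕ) : ℤ) ∣ ((n₂ : ℤ) - n₁) then (1 : ℂ) else 0) =
      ∑ k ∈ Icc 1 Kmax,
        ((if ((q₀ * r * k : ℕ) : ℤ) = 1 * ((n₂ : ℤ) - n₁) ∧ δ ∣ r then (1 : ℂ) else 0) +
          (if ((q₀ * r * k : ℕ) : ℤ) = (-1) * ((n₂ : ℤ) - n₁) ∧ δ ∣ r then (1 : ℂ) else 0)) := by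
  have hq0r : (0 : ℤ) < ((q₀ * r : ℕ) : ℤ) := by positivity
  by_cases hδr : δ ∣ r
  swap
  · simp [hδr]
  simp only [hδr, and_true, true_and, one_mul, neg_mul]
  by_cases hdiv : ((q₀ * r : ℕ) : ℤ) ∣ ((n₂ : ℤ) - n₁)
  · rw [if_pos hdiv]
    obtain ⟨κ, hκ⟩ := hdiv
    have hκ0 : κ ≠ 0 := by
      rintro rfl
      rw [mul_zero, sub_eq_zero] at hκ
      exact hne (by exact_mod_cast hκ.symm)
    have hκK := hK κ hκ.symm
    have hcast : ∀ k : ℕ, ((q₀ * r * k : ℕ) : ℤ) = ((q₀ * r : ℕ) : ℤ) * k := fun k => by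
      push_cast; ring
    simp_rw [hcast, hκ]
    rcases lt_or_gt_of_ne hκ0 with hneg | hpos
    · -- `κ < 0`: only the second family, at `k = -κ`
      set k₀ : ℕ := (-κ).toNat with hk₀
      have hk₀Z : (k₀ : ℤ) = -κ := Int.toNat_of_nonneg (by omega)
      have hk₀mem : k₀ ∈ Icc 1 Kmax := by
        rw [Finset.mem_Icc]; constructor
        · omega
        · have : ((-κ).toNat : ℤ) ≤ Kmax := by rw [hk₀Z]; omega
          omega
      rw [Finset.sum_eq_single_of_mem k₀ hk₀mem]
      · rw [if_neg, if_pos, zero_add]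
        · rw [hk₀Z]; ring
        · intro h
          have := mul_left_cancel₀ hq0r.ne' h
          omega
      · intro k _ hk
        rw [if_neg, if_neg, add_zero]
        · intro h
          rw [← mul_neg] at h
          have := mul_left_cancel₀ hq0r.ne' h
          apply hk
          have : (k : ℤ) = k₀ := by rw [hk₀Z, this]
          exact_mod_cast this
        · intro h
          have := mul_left_cancel₀ hq0r.ne' h
          omega
    · -- `κ > 0`: only the first family, at `k = κ`
      set k₀ : ℕ := κ.toNat with hk₀
      have hk₀Z : (k₀ : ℤ) = κ := Int.toNat_of_nonneg hpos.le
      have hk₀mem : k₀ ∈ Icc 1 Kmax := by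
        rw [Finset.mem_Icc]; constructor
        · omega
        · have : (κ.toNat : ℤ) ≤ Kmax := by rw [hk₀Z]; omega
          omega
      rw [Finset.sum_eq_single_of_mem k₀ hk₀mem]
      · rw [if_pos, if_neg, add_zero]
        · intro h
          rw [← mul_neg] at h
          have := mul_left_cancel₀ hq0r.ne' h
          omega
        · rw [hk₀Z]
      · intro k _ hk
        rw [if_neg, if_neg, add_zero]
        · intro h
          rw [← mul_neg] at h
          have := mul_left_cancel₀ hq0r.ne' h
          omega
        · intro h
          have := mul_left_cancel₀ hq0r.ne' h
          apply hk
          have : (k : ℤ) = k₀ := by rw [hk₀Z, this]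
          exact_mod_cast this
  · rw [if_neg hdiv]
    symm
    refine Finset.sum_eq_zero fun k _ => ?_
    rw [if_neg, if_neg, add_zero]
    · intro h
      apply hdiv
      refine ⟨-k, ?_⟩
      have : ((q₀ * r * k : ℕ) : ℤ) = ((q₀ * r : ℕ) : ℤ) * k := by push_cast; ring
      rw [this] at h
      linear_combination h
    · intro h
      apply hdiv
      refine ⟨k, ?_⟩
      have : ((q₀ * r * k : ℕ) : ℤ) = ((q₀ * r : ℕ) : ℤ) * k := by push_cast; ring
      rw [this] at h
      linear_combination -h

/-- **(E2) The change of variable `r ↦ k`** (BFI (9.3)–(9.6)): for fixed `δ, q₀, q₁, q₂` and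
`n₁ ≠ n₂`, the `r`-sum of (9.2) equals the `k`-sum of the core terms of both signs.
[cite: BombieriFriedlanderIwaniecActa1986, §9 (9.3)–(9.6) p. 228] -/
theorem sum_r_eq_sum_k (a : ℤ) (M Y H : ℝ) {R : ℝ} (hR : 0 ≤ R) {q₀ δ q₁ q₂ : ℕ} (hq₀ : 0 < q₀)
    (hδ : 0 < δ) (hq₁ : 0 < q₁) (hq₂ : 0 < q₂) {n₁ n₂ : ℕ} (hne : n₁ ≠ n₂) {Kmax : ℕ}
    (hK : ∀ r ∈ dyadic R, ∀ κ : ℤ, ((q₀ * r : ℕ) : ℤ) * κ = (n₂ : ℤ) - n₁ → κ.natAbs ≤ Kmax) :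
    ∑ r ∈ dyadic R, (if δ ∣ r ∧ ((q₀ * r : ℕ) : ℤ) ∣ ((n₂ : ℤ) - n₁) then
        rTerm a M Y H q₀ q₁ q₂ n₁ n₂ r else 0) =
      ∑ k ∈ Icc 1 Kmax,
        ((if KCond 1 R q₀ δ k n₁ n₂ then coreTerm a 1 M Y H k q₁ q₂ n₁ n₂ else 0) +
          (if KCond (-1) R q₀ δ k n₁ n₂ then coreTerm a (-1) M Y H k q₁ q₂ n₁ n₂ else 0)) := by
  -- insert (E3)
  have step1 : ∀ r ∈ dyadic R, (if δ ∣ r ∧ ((q₀ * r : ℕ) : ℤ) ∣ ((n₂ : ℤ) - n₁) then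
      rTerm a M Y H q₀ q₁ q₂ n₁ n₂ r else 0) =
      ∑ k ∈ Icc 1 Kmax,
        ((if ((q₀ * r * k : ℕ) : ℤ) = 1 * ((n₂ : ℤ) - n₁) ∧ δ ∣ r then
            rTerm a M Y H q₀ q₁ q₂ n₁ n₂ r else 0) +
          (if ((q₀ * r * k : ℕ) : ℤ) = (-1) * ((n₂ : ℤ) - n₁) ∧ δ ∣ r then
            rTerm a M Y H q₀ q₁ q₂ n₁ n₂ r else 0)) := by
    intro r hr
    have hr0 : 0 < r := pos_of_mem_dyadic hR hr
    have hind := indicator_dvd_eq_sum_k (δ := δ) hq₀ hr0 hne (hK r hr)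
    have key : ∀ (P : Prop) [Decidable P], (if P then rTerm a M Y H q₀ q₁ q₂ n₁ n₂ r else 0) =
        (if P then (1 : ℂ) else 0) * rTerm a M Y H q₀ q₁ q₂ n₁ n₂ r := by
      intro P _; split_ifs <;> simp
    rw [key, hind, Finset.sum_mul]
    refine Finset.sum_congr rfl fun k _ => ?_
    rw [add_mul, ← key, ← key]
  rw [Finset.sum_congr rfl step1, Finset.sum_comm]
  refine Finset.sum_congr rfl fun k hk => ?_
  have hk0 : 0 < k := (Finset.mem_Icc.1 hk).1
  rw [Finset.sum_add_distrib, sum_r_graph_eq a M Y H hR (Or.inl rfl) hq₀ hδ hk0 hq₁ hq₂ n₁ n₂,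
    sum_r_graph_eq a M Y H hR (Or.inr rfl) hq₀ hδ hk0 hq₁ hq₂ n₁ n₂]


/-- The bound `|k| ≤ ⌊N/R⌋` of (9.6): for `r ∼ R` (`R > 0`), `q₀ ≥ 1` and `n₁, n₂ ∼ N`,
`q₀ r κ = n₂ − n₁` forces `|κ| ≤ ⌊N/R⌋`. [cite: BombieriFriedlanderIwaniecActa1986, §9 (9.6) p. 228] -/
theorem natAbs_le_floor_of_rel {N R : ℝ} (hN : 0 ≤ N) (hR : 0 < R) {q₀ r n₁ n₂ : ℕ} (hq₀ : 0 < q₀)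
    (hr : r ∈ dyadic R) (hn₁ : n₁ ∈ dyadic N) (hn₂ : n₂ ∈ dyadic N) {κ : ℤ}
    (hκ : ((q₀ * r : ℕ) : ℤ) * κ = (n₂ : ℤ) - n₁) : κ.natAbs ≤ ⌊N / R⌋₊ := by
  have hrR := ((mem_dyadic hR.le).1 hr).1
  have h1 := (mem_dyadic hN).1 hn₁
  have h2 := (mem_dyadic hN).1 hn₂
  have hr0 : (0 : ℝ) < r := hR.trans hrR
  have hq1 : (1 : ℝ) ≤ q₀ := by exact_mod_cast hq₀
  -- `|n₂ - n₁| < N`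
  have hdiff : |((n₂ : ℝ) - n₁)| < N := by
    rw [abs_lt]; constructor <;> linarith
  have hκR : (q₀ : ℝ) * r * κ = (n₂ : ℝ) - n₁ := by
    have := congrArg (fun z : ℤ => (z : ℝ)) hκ
    push_cast at this
    linarith
  have habs : (κ.natAbs : ℝ) = |(κ : ℝ)| := by
    rw [Nat.cast_natAbs, Int.cast_abs]
  have hlt : (κ.natAbs : ℝ) < N / R := by
    rw [habs, lt_div_iff₀ hR]
    have : |(κ : ℝ)| * ((q₀ : ℝ) * r) = |((n₂ : ℝ) - n₁)| := by
      rw [← hκR, abs_mul, abs_mul, abs_of_pos hr0, abs_of_pos (by positivity : (0 : ℝ) < q₀)]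
      ring
    calc |(κ : ℝ)| * R ≤ |(κ : ℝ)| * ((q₀ : ℝ) * r) := by
          refine mul_le_mul_of_nonneg_left ?_ (abs_nonneg _)
          nlinarith
      _ = |((n₂ : ℝ) - n₁)| := this
      _ < N := hdiff
  have := Nat.lt_floor_add_one (N / R)
  have h3 : (κ.natAbs : ℝ) < ⌊N / R⌋₊ + 1 := hlt.trans this
  exact_mod_cast Nat.lt_add_one_iff.1 (by exact_mod_cast h3)

/-- `(n₁q₂, n₂q₁) = 1` with `n₁, n₂ > 1`... in fact with `n₁ ∼ N`, `N ≥ 1`, forces `n₁ ≠ n₂`. [folklore] -/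
theorem ne_of_cop {N : ℝ} (hN : 1 ≤ N) {q₁ q₂ n₁ n₂ : ℕ} (hn₁ : n₁ ∈ dyadic N)
    (hcop : (n₁ * q₂).Coprime (n₂ * q₁)) : n₁ ≠ n₂ := by
  rintro rfl
  have h1 := ((mem_dyadic (zero_le_one.trans hN)).1 hn₁).1
  have hn : 1 < n₁ := by exact_mod_cast hN.trans_lt h1
  have hd : n₁ ∣ Nat.gcd (n₁ * q₂) (n₁ * q₁) := Nat.dvd_gcd (dvd_mul_right _ _) (dvd_mul_right _ _)
  rw [hcop] at hd
  exact absurd (Nat.le_of_dvd one_pos hd) (not_le.2 hn)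

/-- **Step 6 of the reindexing**: for fixed `δ, q₀, q₁, q₂`,
`∑_{r ∼ R, δ ∣ r} ∑_{(n₁q₂,n₂q₁)=1, q₀r ∣ n₂−n₁} β β Φ(r) = ∑_{k ≤ N/R} ∑_{n₁,n₂} (core terms of both signs)`.
[cite: BombieriFriedlanderIwaniecActa1986, §9 (9.2)–(9.6) p. 228] -/
theorem sum_r_nn_eq_sum_k (a : ℤ) (M Y H : ℝ) {N R : ℝ} (hN : 1 ≤ N) (hR : 0 < R) (β : ℕ → ℝ)
    {q₀ δ q₁ q₂ : ℕ} (hq₀ : 0 < q₀) (hδ : 0 < δ) (hq₁ : 0 < q₁) (hq₂ : 0 < q₂) :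
    ∑ r ∈ dyadic R, (if δ ∣ r then ∑ n₁ ∈ dyadic N, ∑ n₂ ∈ dyadic N,
        (if (n₁ * q₂).Coprime (n₂ * q₁) ∧ ((q₀ * r : ℕ) : ℤ) ∣ ((n₂ : ℤ) - n₁) then
          ((β n₁ * β n₂ : ℝ) : ℂ) * rTerm a M Y H q₀ q₁ q₂ n₁ n₂ r else 0) else 0) =
      ∑ k ∈ Icc 1 ⌊N / R⌋₊, ∑ n₁ ∈ dyadic N, ∑ n₂ ∈ dyadic N,
        ((if CoreCond 1 R q₀ δ k q₁ q₂ n₁ n₂ then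
            ((β n₁ * β n₂ : ℝ) : ℂ) * coreTerm a 1 M Y H k q₁ q₂ n₁ n₂ else 0) +
          (if CoreCond (-1) R q₀ δ k q₁ q₂ n₁ n₂ then
            ((β n₁ * β n₂ : ℝ) : ℂ) * coreTerm a (-1) M Y H k q₁ q₂ n₁ n₂ else 0)) := by
  have hN0 : 0 ≤ N := zero_le_one.trans hN
  -- move the `r`-sum inside
  have e1 : ∑ r ∈ dyadic R, (if δ ∣ r then ∑ n₁ ∈ dyadic N, ∑ n₂ ∈ dyadic N,
        (if (n₁ * q₂).Coprime (n₂ * q₁) ∧ ((q₀ * r : ℕ) : ℤ) ∣ ((n₂ : ℤ) - n₁) then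
          ((β n₁ * β n₂ : ℝ) : ℂ) * rTerm a M Y H q₀ q₁ q₂ n₁ n₂ r else 0) else 0) =
      ∑ n₁ ∈ dyadic N, ∑ n₂ ∈ dyadic N, ((β n₁ * β n₂ : ℝ) : ℂ) *
        (if (n₁ * q₂).Coprime (n₂ * q₁) then
          ∑ r ∈ dyadic R, (if δ ∣ r ∧ ((q₀ * r : ℕ) : ℤ) ∣ ((n₂ : ℤ) - n₁) then
            rTerm a M Y H q₀ q₁ q₂ n₁ n₂ r else 0) else 0) := by
    have e1a : ∀ r ∈ dyadic R, (if δ ∣ r then ∑ n₁ ∈ dyadic N, ∑ n₂ ∈ dyadic N,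
        (if (n₁ * q₂).Coprime (n₂ * q₁) ∧ ((q₀ * r : ℕ) : ℤ) ∣ ((n₂ : ℤ) - n₁) then
          ((β n₁ * β n₂ : ℝ) : ℂ) * rTerm a M Y H q₀ q₁ q₂ n₁ n₂ r else 0) else 0) =
        ∑ n₁ ∈ dyadic N, ∑ n₂ ∈ dyadic N, ((β n₁ * β n₂ : ℝ) : ℂ) *
          (if (n₁ * q₂).Coprime (n₂ * q₁) then
            (if δ ∣ r ∧ ((q₀ * r : ℕ) : ℤ) ∣ ((n₂ : ℤ) - n₁) then
              rTerm a M Y H q₀ q₁ q₂ n₁ n₂ r else 0) else 0) := by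
      intro r _
      by_cases hδr : δ ∣ r
      · rw [if_pos hδr]
        refine Finset.sum_congr rfl fun n₁ _ => Finset.sum_congr rfl fun n₂ _ => ?_
        by_cases hc : (n₁ * q₂).Coprime (n₂ * q₁)
        · rw [if_pos hc]
          by_cases hd : ((q₀ * r : ℕ) : ℤ) ∣ ((n₂ : ℤ) - n₁)
          · rw [if_pos ⟨hc, hd⟩, if_pos ⟨hδr, hd⟩]
          · rw [if_neg (fun h => hd h.2), if_neg (fun h => hd h.2), mul_zero]
        · rw [if_neg hc, if_neg (fun h => hc h.1), mul_zero]
      · rw [if_neg hδr]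
        symm
        refine Finset.sum_eq_zero fun n₁ _ => Finset.sum_eq_zero fun n₂ _ => ?_
        by_cases hc : (n₁ * q₂).Coprime (n₂ * q₁)
        · rw [if_pos hc, if_neg (fun h => hδr h.1), mul_zero]
        · rw [if_neg hc, mul_zero]
    rw [Finset.sum_congr rfl e1a, Finset.sum_comm]
    refine Finset.sum_congr rfl fun n₁ _ => ?_
    rw [Finset.sum_comm]
    refine Finset.sum_congr rfl fun n₂ _ => ?_
    rw [← Finset.mul_sum]
    congr 1
    by_cases hc : (n₁ * q₂).Coprime (n₂ * q₁)
    · rw [if_pos hc]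
      refine Finset.sum_congr rfl fun r _ => ?_
      rw [if_pos hc]
    · rw [if_neg hc]
      refine Finset.sum_eq_zero fun r _ => ?_
      rw [if_neg hc]
  rw [e1]
  -- apply (E2) termwise
  have e2 : ∀ n₁ ∈ dyadic N, ∀ n₂ ∈ dyadic N, ((β n₁ * β n₂ : ℝ) : ℂ) *
      (if (n₁ * q₂).Coprime (n₂ * q₁) then
        ∑ r ∈ dyadic R, (if δ ∣ r ∧ ((q₀ * r : ℕ) : ℤ) ∣ ((n₂ : ℤ) - n₁) then
          rTerm a M Y H q₀ q₁ q₂ n₁ n₂ r else 0) else 0) =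
      ∑ k ∈ Icc 1 ⌊N / R⌋₊,
        ((if CoreCond 1 R q₀ δ k q₁ q₂ n₁ n₂ then
            ((β n₁ * β n₂ : ℝ) : ℂ) * coreTerm a 1 M Y H k q₁ q₂ n₁ n₂ else 0) +
          (if CoreCond (-1) R q₀ δ k q₁ q₂ n₁ n₂ then
            ((β n₁ * β n₂ : ℝ) : ℂ) * coreTerm a (-1) M Y H k q₁ q₂ n₁ n₂ else 0)) := by
    intro n₁ hn₁ n₂ hn₂
    by_cases hc : (n₁ * q₂).Coprime (n₂ * q₁)
    · rw [if_pos hc, sum_r_eq_sum_k a M Y H hR.le hq₀ hδ hq₁ hq₂ (ne_of_cop hN hn₁ hc)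
        (fun r hr κ hκ => natAbs_le_floor_of_rel hN0 hR hq₀ hr hn₁ hn₂ hκ), Finset.mul_sum]
      refine Finset.sum_congr rfl fun k _ => ?_
      rw [mul_add]
      congr 1
      · by_cases h1 : KCond 1 R q₀ δ k n₁ n₂
        · rw [if_pos h1, if_pos (show CoreCond 1 R q₀ δ k q₁ q₂ n₁ n₂ from ⟨hc, h1⟩)]
        · rw [if_neg h1, if_neg (fun h : CoreCond 1 R q₀ δ k q₁ q₂ n₁ n₂ => h1 h.2), mul_zero]
      · by_cases h1 : KCond (-1) R q₀ δ k n₁ n₂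
        · rw [if_pos h1, if_pos (show CoreCond (-1) R q₀ δ k q₁ q₂ n₁ n₂ from ⟨hc, h1⟩)]
        · rw [if_neg h1, if_neg (fun h : CoreCond (-1) R q₀ δ k q₁ q₂ n₁ n₂ => h1 h.2), mul_zero]
    · rw [if_neg hc, mul_zero]
      symm
      refine Finset.sum_eq_zero fun k _ => ?_
      rw [if_neg (fun h : CoreCond 1 R q₀ δ k q₁ q₂ n₁ n₂ => hc h.1),
        if_neg (fun h : CoreCond (-1) R q₀ δ k q₁ q₂ n₁ n₂ => hc h.1), add_zero]
  symm
  rw [Finset.sum_comm]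
  refine Finset.sum_congr rfl fun n₁ hn₁ => ?_
  rw [Finset.sum_comm]
  refine Finset.sum_congr rfl fun n₂ hn₂ => ?_
  exact (e2 n₁ hn₁ n₂ hn₂).symm


/-- `IsCoprime (n : ℤ) a ↔ (n, |a|) = 1` for natural `n`. [folklore] -/
theorem isCoprime_natCast_iff (n : ℕ) (a : ℤ) : IsCoprime ((n : ℕ) : ℤ) a ↔ n.Coprime a.natAbs := by
  rw [Int.isCoprime_iff_gcd_eq_one, Int.gcd_eq_natAbs, Int.natAbs_natCast]

/-- **`ℛ₁(q₀)` after Möbius inversion of `(r, a) = 1` and the change of variable `r ↦ k`**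
(BFI (9.2)–(9.6), p. 228):
`ℛ₁⁺(q₀) = ∑_{δ ∣ a} μ(δ) (Core₊(δ) + Core₋(δ))` with the `k`-range `1 ≤ k ≤ ⌊N/R⌋`.
[cite: BombieriFriedlanderIwaniecActa1986, §9 (9.2)–(9.6) p. 228] -/
theorem dispR1q0_eq_sum_moebius {a : ℤ} (ha : a ≠ 0) (M Y H : ℝ) {N Q R : ℝ} (hN : 1 ≤ N)
    (hQ : 0 ≤ Q) (hR : 0 < R) (β γ : ℕ → ℝ) {q₀ : ℕ} (hq₀ : 0 < q₀) :
    dispR1q0 a M Y N Q R H β γ q₀ =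
      ∑ δ ∈ a.natAbs.divisors, (ArithmeticFunction.moebius δ : ℂ) *
        (coreSum a 1 M Y N Q R H β γ q₀ δ (Icc 1 ⌊N / R⌋₊) +
          coreSum a (-1) M Y N Q R H β γ q₀ δ (Icc 1 ⌊N / R⌋₊)) := by
  set A : ℕ := a.natAbs with hAdef
  have hA : 0 < A := Int.natAbs_pos.2 ha
  set S := qSet Q q₀ with hS
  have hSpos : ∀ q ∈ S, 0 < q := fun q hq => (qSet_bounds hQ hq₀ hq).1
  -- the weight `w(q₁,q₂) = [P] γ γ` and the inner sums
  set w : ℕ → ℕ → ℂ := fun q₁ q₂ =>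
    if q₁.Coprime q₂ ∧ (q₀ * q₁ * q₂).Coprime A then ((γ (q₀ * q₁) * γ (q₀ * q₂) : ℝ) : ℂ) else 0
    with hw
  set G : ℕ → ℕ → ℕ → ℂ := fun r q₁ q₂ => ∑ n₁ ∈ dyadic N, ∑ n₂ ∈ dyadic N,
    (if (n₁ * q₂).Coprime (n₂ * q₁) ∧ ((q₀ * r : ℕ) : ℤ) ∣ ((n₂ : ℤ) - n₁) then
      ((β n₁ * β n₂ : ℝ) : ℂ) * rTerm a M Y H q₀ q₁ q₂ n₁ n₂ r else 0) with hG
  -- Step 1: the summand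
  have step1 : ∀ r ∈ dyadic R, ∀ q₁ ∈ S, ∀ q₂ ∈ S,
      (if q₁.Coprime q₂ ∧ IsCoprime ((q₀ * q₁ * q₂ * r : ℕ) : ℤ) a then
        ((γ (q₀ * q₁) * γ (q₀ * q₂) / ((q₀ * q₁ * q₂ * r : ℕ) : ℝ) : ℝ) : ℂ) *
          ∑ n₁ ∈ dyadic N, ∑ n₂ ∈ dyadic N,
            if (n₁ * q₂).Coprime (n₂ * q₁) ∧ ((q₀ * r : ℕ) : ℤ) ∣ ((n₂ : ℤ) - n₁) then
              ((β n₁ * β n₂ : ℝ) : ℂ) * ∑ h ∈ Icc 1 ⌊H⌋₊,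
                hTerm a M Y (q₀ * q₁ * q₂ * r) (n₁ * q₂) (n₂ * q₁) (((n₂ : ℤ) - n₁) / (q₀ * r)) h
            else 0
        else 0) = w q₁ q₂ * (if r.Coprime A then G r q₁ q₂ else 0) := by
    intro r hr q₁ hq₁ q₂ hq₂
    simp only [hw, hG]
    have hiff : IsCoprime ((q₀ * q₁ * q₂ * r : ℕ) : ℤ) a ↔ (q₀ * q₁ * q₂).Coprime A ∧ r.Coprime A := by
      rw [isCoprime_natCast_iff, Nat.coprime_mul_iff_left]
    by_cases hP : q₁.Coprime q₂ ∧ (q₀ * q₁ * q₂).Coprime A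
    · by_cases hrA : r.Coprime A
      · rw [if_pos ⟨hP.1, hiff.2 ⟨hP.2, hrA⟩⟩, if_pos hP, if_pos hrA, Finset.mul_sum, Finset.mul_sum]
        refine Finset.sum_congr rfl fun n₁ _ => ?_
        rw [Finset.mul_sum, Finset.mul_sum]
        refine Finset.sum_congr rfl fun n₂ _ => ?_
        split_ifs
        · unfold rTerm; push_cast; ring
        · simp
      · rw [if_neg (fun h => hrA (hiff.1 h.2).2), if_pos hP, if_neg hrA, mul_zero]
    · rw [if_neg (fun h => hP ⟨h.1, (hiff.1 h.2).1⟩), if_neg hP, zero_mul]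
  -- Step 2: `r` inside, Möbius, and the change of variables
  have step2 : ∀ q₁ ∈ S, ∀ q₂ ∈ S,
      ∑ r ∈ dyadic R, w q₁ q₂ * (if r.Coprime A then G r q₁ q₂ else 0) =
        w q₁ q₂ * ∑ δ ∈ A.divisors, (ArithmeticFunction.moebius δ : ℂ) *
          ∑ k ∈ Icc 1 ⌊N / R⌋₊, ∑ n₁ ∈ dyadic N, ∑ n₂ ∈ dyadic N,
            ((if CoreCond 1 R q₀ δ k q₁ q₂ n₁ n₂ then
                ((β n₁ * β n₂ : ℝ) : ℂ) * coreTerm a 1 M Y H k q₁ q₂ n₁ n₂ else 0) +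
              (if CoreCond (-1) R q₀ δ k q₁ q₂ n₁ n₂ then
                ((β n₁ * β n₂ : ℝ) : ℂ) * coreTerm a (-1) M Y H k q₁ q₂ n₁ n₂ else 0)) := by
    intro q₁ hq₁ q₂ hq₂
    rw [← Finset.mul_sum]
    congr 1
    rw [← Finset.sum_filter, sum_filter_coprime_eq_sum_divisors (dyadic R) (fun r => G r q₁ q₂) hA]
    refine Finset.sum_congr rfl fun δ hδ => ?_
    congr 1
    rw [Finset.sum_filter]
    exact sum_r_nn_eq_sum_k a M Y H hN hR β hq₀ (Nat.pos_of_mem_divisors hδ) (hSpos q₁ hq₁)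
      (hSpos q₂ hq₂)
  -- Step 3: assemble
  set V : ℕ → ℕ → ℕ → ℂ := fun δ q₁ q₂ => ∑ k ∈ Icc 1 ⌊N / R⌋₊, ∑ n₁ ∈ dyadic N, ∑ n₂ ∈ dyadic N,
    ((if CoreCond 1 R q₀ δ k q₁ q₂ n₁ n₂ then
        ((β n₁ * β n₂ : ℝ) : ℂ) * coreTerm a 1 M Y H k q₁ q₂ n₁ n₂ else 0) +
      (if CoreCond (-1) R q₀ δ k q₁ q₂ n₁ n₂ then
        ((β n₁ * β n₂ : ℝ) : ℂ) * coreTerm a (-1) M Y H k q₁ q₂ n₁ n₂ else 0)) with hV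
  have lhs : dispR1q0 a M Y N Q R H β γ q₀ =
      ∑ p ∈ S ×ˢ S, w p.1 p.2 * ∑ δ ∈ A.divisors, (ArithmeticFunction.moebius δ : ℂ) * V δ p.1 p.2 := by
    unfold dispR1q0
    rw [← hS]
    calc _ = ∑ r ∈ dyadic R, ∑ q₁ ∈ S, ∑ q₂ ∈ S, w q₁ q₂ * (if r.Coprime A then G r q₁ q₂ else 0) :=
          Finset.sum_congr rfl fun r hr => Finset.sum_congr rfl fun q₁ hq₁ =>
            Finset.sum_congr rfl fun q₂ hq₂ => step1 r hr q₁ hq₁ q₂ hq₂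
      _ = ∑ r ∈ dyadic R, ∑ p ∈ S ×ˢ S, w p.1 p.2 * (if r.Coprime A then G r p.1 p.2 else 0) := by
          refine Finset.sum_congr rfl fun r _ => ?_
          rw [Finset.sum_product' (f := fun q₁ q₂ => w q₁ q₂ * (if r.Coprime A then G r q₁ q₂ else 0))]
      _ = ∑ p ∈ S ×ˢ S, ∑ r ∈ dyadic R, w p.1 p.2 * (if r.Coprime A then G r p.1 p.2 else 0) :=
          Finset.sum_comm
      _ = _ := by
          refine Finset.sum_congr rfl fun p hp => ?_
          rw [Finset.mem_product] at hp
          exact step2 p.1 hp.1 p.2 hp.2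
  have rhs : ∀ sg : ℤ, coreSum a sg M Y N Q R H β γ q₀ = fun δ Kset =>
      ∑ k ∈ Kset, ∑ p ∈ S ×ˢ S, w p.1 p.2 * ∑ n₁ ∈ dyadic N, ∑ n₂ ∈ dyadic N,
        (if CoreCond sg R q₀ δ k p.1 p.2 n₁ n₂ then
          ((β n₁ * β n₂ : ℝ) : ℂ) * coreTerm a sg M Y H k p.1 p.2 n₁ n₂ else 0) := by
    intro sg
    funext δ Kset
    unfold coreSum
    rw [← hS]
    refine Finset.sum_congr rfl fun k _ => ?_
    rw [Finset.sum_product' (f := fun q₁ q₂ => w q₁ q₂ * ∑ n₁ ∈ dyadic N, ∑ n₂ ∈ dyadic N,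
        (if CoreCond sg R q₀ δ k q₁ q₂ n₁ n₂ then
          ((β n₁ * β n₂ : ℝ) : ℂ) * coreTerm a sg M Y H k q₁ q₂ n₁ n₂ else 0))]
    refine Finset.sum_congr rfl fun q₁ _ => Finset.sum_congr rfl fun q₂ _ => ?_
    simp only [hw]
    split_ifs
    · rfl
    · rw [zero_mul]
  rw [lhs, rhs 1, rhs (-1)]
  simp only
  -- both sides are `∑_δ ∑_k ∑_p μ(δ) w V`-type sums
  calc ∑ p ∈ S ×ˢ S, w p.1 p.2 * ∑ δ ∈ A.divisors, (ArithmeticFunction.moebius δ : ℂ) * V δ p.1 p.2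
      = ∑ p ∈ S ×ˢ S, ∑ δ ∈ A.divisors, (ArithmeticFunction.moebius δ : ℂ) * (w p.1 p.2 * V δ p.1 p.2) := by
        refine Finset.sum_congr rfl fun p _ => ?_
        rw [Finset.mul_sum]
        refine Finset.sum_congr rfl fun δ _ => ?_
        ring
    _ = ∑ δ ∈ A.divisors, ∑ p ∈ S ×ˢ S, (ArithmeticFunction.moebius δ : ℂ) * (w p.1 p.2 * V δ p.1 p.2) :=
        Finset.sum_comm
    _ = ∑ δ ∈ A.divisors, (ArithmeticFunction.moebius δ : ℂ) * ∑ p ∈ S ×ˢ S, w p.1 p.2 * V δ p.1 p.2 := by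
        refine Finset.sum_congr rfl fun δ _ => ?_
        rw [Finset.mul_sum]
    _ = _ := by
        refine Finset.sum_congr rfl fun δ _ => ?_
        congr 1
        simp only [hV]
        rw [← Finset.sum_add_distrib]
        calc ∑ p ∈ S ×ˢ S, w p.1 p.2 * ∑ k ∈ Icc 1 ⌊N / R⌋₊, ∑ n₁ ∈ dyadic N, ∑ n₂ ∈ dyadic N,
              ((if CoreCond 1 R q₀ δ k p.1 p.2 n₁ n₂ then
                  ((β n₁ * β n₂ : ℝ) : ℂ) * coreTerm a 1 M Y H k p.1 p.2 n₁ n₂ else 0) +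
                (if CoreCond (-1) R q₀ δ k p.1 p.2 n₁ n₂ then
                  ((β n₁ * β n₂ : ℝ) : ℂ) * coreTerm a (-1) M Y H k p.1 p.2 n₁ n₂ else 0))
            = ∑ p ∈ S ×ˢ S, ∑ k ∈ Icc 1 ⌊N / R⌋₊, w p.1 p.2 * ∑ n₁ ∈ dyadic N, ∑ n₂ ∈ dyadic N,
              ((if CoreCond 1 R q₀ δ k p.1 p.2 n₁ n₂ then
                  ((β n₁ * β n₂ : ℝ) : ℂ) * coreTerm a 1 M Y H k p.1 p.2 n₁ n₂ else 0) +
                (if CoreCond (-1) R q₀ δ k p.1 p.2 n₁ n₂ then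
                  ((β n₁ * β n₂ : ℝ) : ℂ) * coreTerm a (-1) M Y H k p.1 p.2 n₁ n₂ else 0)) := by
              refine Finset.sum_congr rfl fun p _ => ?_
              rw [Finset.mul_sum]
          _ = ∑ k ∈ Icc 1 ⌊N / R⌋₊, ∑ p ∈ S ×ˢ S, w p.1 p.2 * ∑ n₁ ∈ dyadic N, ∑ n₂ ∈ dyadic N,
              ((if CoreCond 1 R q₀ δ k p.1 p.2 n₁ n₂ then
                  ((β n₁ * β n₂ : ℝ) : ℂ) * coreTerm a 1 M Y H k p.1 p.2 n₁ n₂ else 0) +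
                (if CoreCond (-1) R q₀ δ k p.1 p.2 n₁ n₂ then
                  ((β n₁ * β n₂ : ℝ) : ℂ) * coreTerm a (-1) M Y H k p.1 p.2 n₁ n₂ else 0)) :=
              Finset.sum_comm
          _ = _ := by
              refine Finset.sum_congr rfl fun k _ => ?_
              rw [← Finset.sum_add_distrib]
              refine Finset.sum_congr rfl fun p _ => ?_
              rw [← mul_add, ← Finset.sum_add_distrib]
              congr 1
              refine Finset.sum_congr rfl fun n₁ _ => ?_
              rw [← Finset.sum_add_distrib]


/-! ## The bridge to `BFI.calR1` of `…DispersionS1` / `…Theorem1R1` -/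

/-! ### The conditions and the terms of `calR1q` in the coordinates `qᵢ = q₀qᵢ'` -/

/-- From `(n₁q', n₂q) = 1`: `(n₁, q) = 1` and `(n₂, q') = 1`. [folklore] -/
theorem coprime_parts_of_cop {n₁ n₂ q q' : ℕ} (h : (n₁ * q').Coprime (n₂ * q)) :
    n₁.Coprime q ∧ n₂.Coprime q' := by
  constructor
  · exact Nat.Coprime.coprime_dvd_right (dvd_mul_left q n₂)
      (Nat.Coprime.coprime_dvd_left (dvd_mul_right n₁ q') h)
  · exact (Nat.Coprime.coprime_dvd_right (dvd_mul_right n₂ q)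
      (Nat.Coprime.coprime_dvd_left (dvd_mul_left q' n₁) h)).symm

/-- The conditions of `ℛ₁⁺(q₀)` (`BFI.calR1q`) at `q₁ = q₀q`, `q₂ = q₀q'` are those of
`BFI.dispR1q0`: for `q₀, r, q, q' ≥ 1`, `q₀ ≤ Q₀`,
`(q₀q, q₀q') = q₀ ∧ main ∧ solvable ↔ ((q,q')=1 ∧ (q₀qq'r, −a)=1) ∧ ((n₁q', n₂q)=1 ∧ q₀r ∣ n₂−n₁)`.
[cite: BombieriFriedlanderIwaniecActa1986, §6 (6.8), (6.14) pp. 220–221] -/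
theorem calR1_conds_iff {a : ℤ} {Q₀ : ℝ} {q₀ r q q' : ℕ} (hq₀ : 0 < q₀)
    (hq₀Q : (q₀ : ℝ) ≤ Q₀) (hr : 0 < r) (hq : 0 < q) (hq' : 0 < q') (n₁ n₂ : ℕ) :
    (Nat.gcd (q₀ * q) (q₀ * q') = q₀ ∧ (Main Q₀ (q₀ * q) (q₀ * q') n₁ n₂ ∧
        Solvable a r (q₀ * q) (q₀ * q') n₁ n₂)) ↔
      ((q.Coprime q' ∧ IsCoprime ((q₀ * q * q' * r : ℕ) : ℤ) (-a)) ∧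
        ((n₁ * q').Coprime (n₂ * q) ∧ ((q₀ * r : ℕ) : ℤ) ∣ ((n₂ : ℤ) - n₁))) := by
  have hq₁ : 0 < q₀ * q := Nat.mul_pos hq₀ hq
  have hq₂ : 0 < q₀ * q' := Nat.mul_pos hq₀ hq'
  unfold Main
  rw [solvable_iff hr hq₁ hq₂, IsCoprime.neg_right_iff, Nat.gcd_mul_left]
  have hgcd : q₀ * Nat.gcd q q' = q₀ ↔ q.Coprime q' := by
    constructor
    · intro h; exact Nat.eq_of_mul_eq_mul_left hq₀ (by rw [h, mul_one])
    · intro h; rw [Nat.Coprime.gcd_eq_one h, mul_one]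
  -- the congruence modulo `gmod = (q₀q, q₀q') r` versus `q₀ r`
  have hcongr : q.Coprime q' →
      (((n₁ : ZMod (gmod r (q₀ * q) (q₀ * q'))) = (n₂ : ZMod (gmod r (q₀ * q) (q₀ * q')))) ↔
        ((q₀ * r : ℕ) : ℤ) ∣ ((n₂ : ℤ) - n₁)) := by
    intro hc
    have e : gmod r (q₀ * q) (q₀ * q') = q₀ * r := by
      unfold gmod; rw [Nat.gcd_mul_left, Nat.Coprime.gcd_eq_one hc, mul_one]
    rw [zmod_natCast_eq_iff_of_eq e, ← Int.cast_natCast (R := ZMod (q₀ * r)) n₁,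
      ← Int.cast_natCast (R := ZMod (q₀ * r)) n₂, ZMod.intCast_eq_intCast_iff_dvd_sub]
  have hprod : ((q₀ * q * (q₀ * q') * r : ℕ) : ℤ) = ((q₀ * q * q' * r : ℕ) : ℤ) * q₀ := by
    push_cast; ring
  constructor
  · rintro ⟨hg, ⟨hcop, _⟩, hka, hn₁c, hn₂c, hcong⟩
    have hc : q.Coprime q' := hgcd.1 hg
    have hdvd := (hcongr hc).1 hcong
    refine ⟨⟨hc, ?_⟩, ?_, hdvd⟩
    · rw [hprod] at hka
      exact IsCoprime.of_mul_left_left hka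
    · have hn₁q : n₁.Coprime q := Nat.Coprime.coprime_dvd_right ⟨q₀ * r, by ring⟩ hn₁c
      have hq'n₂ : q'.Coprime n₂ := (Nat.Coprime.coprime_dvd_right ⟨q₀ * r, by ring⟩ hn₂c).symm
      exact Nat.Coprime.mul_left (Nat.Coprime.mul_right hcop hn₁q)
        (Nat.Coprime.mul_right hq'n₂ hc.symm)
  · rintro ⟨⟨hc, hka⟩, hfil, hdvd⟩
    have hcop : n₁.Coprime n₂ := coprime_of_cop hfil
    have hn₁g : n₁.Coprime (q₀ * r) := coprime_of_dvd_sub hcop hdvd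
    have hn₂g : n₂.Coprime (q₀ * r) := by
      have hdvd' : ((q₀ * r : ℕ) : ℤ) ∣ ((n₁ : ℤ) - n₂) := by
        have := hdvd.neg_right; rwa [neg_sub] at this
      exact coprime_of_dvd_sub hcop.symm hdvd'
    obtain ⟨hn₁q, hn₂q'⟩ := coprime_parts_of_cop hfil
    refine ⟨hgcd.2 hc, ⟨hcop, ?_⟩, ?_, ?_, ?_, (hcongr hc).2 hdvd⟩
    · rw [hgcd.2 hc]; exact hq₀Q
    · rw [hprod]
      have hka' : IsCoprime ((q₀ : ℤ) * q * q' * r) a := by push_cast at hka; exact hka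
      exact IsCoprime.mul_left hka (IsCoprime.of_mul_left_left
        (IsCoprime.of_mul_left_left (IsCoprime.of_mul_left_left hka')))
    · have : n₁.Coprime (q * (q₀ * r)) := Nat.Coprime.mul_right hn₁q hn₁g
      rwa [show q₀ * q * r = q * (q₀ * r) by ring]
    · have : n₂.Coprime (q' * (q₀ * r)) := Nat.Coprime.mul_right hn₂q' hn₂g
      rwa [show q₀ * q' * r = q' * (q₀ * r) by ring]


/-- For `(q, q') = 1`: `L = lmod r (q₀q) (q₀q') = q₀qq'r`. [folklore] -/
theorem lmod_mul_mul_eq {q₀ q q' : ℕ} (hc : q.Coprime q') (r : ℕ) :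
    lmod r (q₀ * q) (q₀ * q') = q₀ * q * q' * r := by
  unfold lmod
  rw [Nat.lcm_mul_left, Nat.Coprime.lcm_eq_mul hc]; ring

/-- **The phase of `calR1` is the phase of `dispR1q0` at `−a`**: for `(q,q') = 1`,
`q₀r ∣ n₂ − n₁`, `n₁, q' ≥ 1`, with `k = (n₂−n₁)/(q₀r)`, `c = n₁q'`,
`e(bfiPhase a r (q₀q) (q₀q') n₁ n₂ h) = e(ρ_{−a} h k / c)`, `ρ_{−a} = (−a)(n₂q)‾ mod c`.
[cite: BombieriFriedlanderIwaniecActa1986, §6 (6.10), (6.14) p. 221] -/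
theorem e_bfiPhase_eq_klNum {a : ℤ} {q₀ r q q' n₁ n₂ : ℕ} (hq₀ : 0 < q₀)
    (hc : q.Coprime q') (hn₁ : 0 < n₁) (hq' : 0 < q')
    (hdvd : ((q₀ * r : ℕ) : ℤ) ∣ ((n₂ : ℤ) - n₁)) (h : ℕ) :
    (𝐞 (bfiPhase a r (q₀ * q) (q₀ * q') n₁ n₂ h) : ℂ) =
      (𝐞 ((klNum (-a) (n₁ * q') (n₂ * q) : ℝ) * h * ((((n₂ : ℤ) - n₁) / (q₀ * r) : ℤ) : ℝ) /
        ((n₁ * q' : ℕ) : ℝ)) : ℂ) := by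
  have hg : Nat.gcd (q₀ * q) (q₀ * q') = q₀ := by
    rw [Nat.gcd_mul_left, Nat.Coprime.gcd_eq_one hc, mul_one]
  rw [bfiPhase_eq_of_gcd a hg n₁ n₂ h, Nat.mul_div_cancel_left q hq₀, Nat.mul_div_cancel_left q' hq₀]
  set c : ℕ := n₁ * q' with hcdef
  have hcpos : 0 < c := Nat.mul_pos hn₁ hq'
  haveI : NeZero c := ⟨hcpos.ne'⟩
  set k : ℤ := ((n₂ : ℤ) - n₁) / (q₀ * r) with hkdef
  set u : ℕ := ((((n₂ * q : ℕ) : ZMod c))⁻¹).val with hu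
  -- `t = (n₁ − n₂)/(q₀r) = −k`
  have ht : ((n₁ : ℤ) - n₂) / ((q₀ * r : ℕ) : ℤ) = -k := by
    rw [hkdef, show ((n₁ : ℤ) - n₂) = -((n₂ : ℤ) - n₁) by ring]
    push_cast
    exact Int.neg_ediv_of_dvd (by exact_mod_cast hdvd)
  -- `klNum (−a) ≡ −a u (mod c)`
  have hmod : (c : ℤ) ∣ (klNum (-a) c (n₂ * q) : ℤ) + a * u := by
    rw [← ZMod.intCast_zmod_eq_zero_iff_dvd]
    push_cast
    unfold klNum
    rw [hu, ZMod.natCast_zmod_val, ZMod.natCast_zmod_val]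
    push_cast; ring
  obtain ⟨m, hm⟩ := hmod
  have hmR : (klNum (-a) c (n₂ * q) : ℝ) + a * u = (c : ℝ) * m := by exact_mod_cast hm
  have hcR : ((n₁ : ℝ) * (q' : ℕ)) = (c : ℝ) := by rw [hcdef]; push_cast; ring
  have hcR' : ((n₁ * q' : ℕ) : ℝ) = (c : ℝ) := by rw [hcdef]
  have hc0 : (c : ℝ) ≠ 0 := by exact_mod_cast hcpos.ne'
  rw [ht, hcR, hcR']
  symm
  refine e_eq_of_sub_int (m * h * k) ?_
  push_cast
  field_simp
  linear_combination ((h : ℝ) * (k : ℝ)) * hmR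

/-- **The term of `calR1q` at `(r, q₀q, q₀q', n₁, n₂)` is the term of `dispR1q0 (−a)`**
(same `L`, same Fourier coefficient, phases equal). [cite: BombieriFriedlanderIwaniecActa1986, §6 (6.14) p. 221] -/
theorem calR1_term_eq {a : ℤ} (M Y : ℝ) (β γ : ℕ → ℝ) (H : ℕ) {q₀ r q q' n₁ n₂ : ℕ} (hq₀ : 0 < q₀)
    (hr : 0 < r) (hq : 0 < q) (hq' : 0 < q') (hc : q.Coprime q') (hn₁ : 0 < n₁)
    (hdvd : ((q₀ * r : ℕ) : ℤ) ∣ ((n₂ : ℤ) - n₁)) :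
    ((γ (q₀ * q) * γ (q₀ * q') * β n₁ * β n₂ : ℝ) : ℂ) *
        (((lmod r (q₀ * q) (q₀ * q') : ℂ))⁻¹ * oscRplus a M Y r (q₀ * q) (q₀ * q') n₁ n₂ H) =
      ((γ (q₀ * q) * γ (q₀ * q') / ((q₀ * q * q' * r : ℕ) : ℝ) : ℝ) : ℂ) *
        (((β n₁ * β n₂ : ℝ)) : ℂ) * ∑ h ∈ Finset.Icc 1 ⌊((H : ℕ) : ℝ)⌋₊,
          hTerm (-a) M Y (q₀ * q * q' * r) (n₁ * q') (n₂ * q) (((n₂ : ℤ) - n₁) / (q₀ * r)) h := by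
  rw [Nat.floor_natCast, lmod_mul_mul_eq hc r]
  unfold oscRplus hTerm
  rw [lmod_mul_mul_eq hc r]
  have hD0 : ((q₀ * q * q' * r : ℕ) : ℂ) ≠ 0 := by
    have : 0 < q₀ * q * q' * r := Nat.mul_pos (Nat.mul_pos (Nat.mul_pos hq₀ hq) hq') hr
    exact_mod_cast this.ne'
  rw [Finset.mul_sum, Finset.mul_sum, Finset.mul_sum]
  refine Finset.sum_congr rfl fun h _ => ?_
  rw [e_bfiPhase_eq_klNum hq₀ hc hn₁ hq' hdvd h, fcoef_def]
  push_cast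
  field_simp

/-- The summand of `calR1q` vanishes unless `q₀ ∣ q₁` and `q₀ ∣ q₂`. [folklore] -/
theorem calR1q_term_eq_zero_of_not_dvd {a : ℤ} {M Y Q₀ : ℝ} {β γ : ℕ → ℝ} {H : ℕ}
    {q₀ r q₁ q₂ n₁ n₂ : ℕ} (h : ¬ q₀ ∣ q₁ ∨ ¬ q₀ ∣ q₂) [Decidable (Nat.gcd q₁ q₂ = q₀ ∧
      (Main Q₀ q₁ q₂ n₁ n₂ ∧ Solvable a r q₁ q₂ n₁ n₂))] :
    (if Nat.gcd q₁ q₂ = q₀ ∧ (Main Q₀ q₁ q₂ n₁ n₂ ∧ Solvable a r q₁ q₂ n₁ n₂) then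
      ((γ q₁ * γ q₂ * β n₁ * β n₂ : ℝ) : ℂ) *
        (((lmod r q₁ q₂ : ℂ))⁻¹ * oscRplus a M Y r q₁ q₂ n₁ n₂ H) else 0) = 0 := by
  rw [if_neg]
  rintro ⟨hg, -⟩
  rcases h with h | h
  · exact h (hg ▸ Nat.gcd_dvd_left q₁ q₂)
  · exact h (hg ▸ Nat.gcd_dvd_right q₁ q₂)

/-- **`ℛ₁⁺(q₀)` of the Theorem-1 line equals `dispR1q0` at `−a`** (`1 ≤ q₀ ≤ Q₀`, `Q, R, N ≥ 0`):
the renderings of (6.14) in the original coordinates `q₁, q₂ ∼ Q` (`BFI.calR1q`, from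
`…Theorem1R1`, derived from `𝒮₁` with Mathlib's Fourier conventions) and in the coordinates
`q₀, q₁', q₂'` (`BFI.dispR1q0`) agree, the phase `e(+hμ/L)` of the former being the phase of the
latter with `a ↦ −a`. [cite: BombieriFriedlanderIwaniecActa1986, §6 (6.14) p. 221] -/
theorem calR1q_eq_dispR1q0 (a : ℤ) (M Y : ℝ) {N Q R Q₀ : ℝ} (hN : 0 ≤ N) (hQ : 0 ≤ Q) (hR : 0 ≤ R)
    (β γ : ℕ → ℝ) (H : ℕ) {q₀ : ℕ} (hq₀ : q₀ ∈ Finset.Icc 1 ⌊Q₀⌋₊) :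
    calR1q a M Y N Q R Q₀ β γ H q₀ = dispR1q0 (-a) M Y N Q R ((H : ℕ) : ℝ) β γ q₀ := by
  classical
  have hq₀pos : 0 < q₀ := (Finset.mem_Icc.1 hq₀).1
  have hq₀Q : (q₀ : ℝ) ≤ Q₀ := by
    have h2 := (Finset.mem_Icc.1 hq₀).2
    have hQ₀ : 0 ≤ Q₀ := by
      by_contra hneg
      rw [Nat.floor_of_nonpos (le_of_lt (not_le.1 hneg))] at h2
      omega
    exact (Nat.cast_le.2 h2).trans (Nat.floor_le hQ₀)
  unfold calR1q dispR1q0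
  refine Finset.sum_congr rfl fun r hr => ?_
  have hrpos : 0 < r := pos_of_mem_dyadic hR hr
  -- Step 1: `q₁ = q₀ q`, `q₂ = q₀ q'`
  set T : ℕ → ℕ → ℂ := fun q₁ q₂ => ∑ n₁ ∈ dyadic N, ∑ n₂ ∈ dyadic N,
    (if Nat.gcd q₁ q₂ = q₀ ∧ (Main Q₀ q₁ q₂ n₁ n₂ ∧ Solvable a r q₁ q₂ n₁ n₂) then
      ((γ q₁ * γ q₂ * β n₁ * β n₂ : ℝ) : ℂ) *
        (((lmod r q₁ q₂ : ℂ))⁻¹ * oscRplus a M Y r q₁ q₂ n₁ n₂ H) else 0) with hT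
  have hT0 : ∀ q₁ q₂, (¬ q₀ ∣ q₁ ∨ ¬ q₀ ∣ q₂) → T q₁ q₂ = 0 := by
    intro q₁ q₂ h
    simp only [hT]
    exact Finset.sum_eq_zero fun n₁ _ => Finset.sum_eq_zero fun n₂ _ =>
      calR1q_term_eq_zero_of_not_dvd h
  have step1 : ∑ q₁ ∈ dyadic Q, ∑ q₂ ∈ dyadic Q, T q₁ q₂ =
      ∑ q ∈ qSet Q q₀, ∑ q' ∈ qSet Q q₀, T (q₀ * q) (q₀ * q') := by
    have e1 : ∀ q₁, ∑ q₂ ∈ dyadic Q, T q₁ q₂ = ∑ q' ∈ qSet Q q₀, T q₁ (q₀ * q') := by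
      intro q₁
      unfold qSet
      rw [Finset.sum_filter, ← sum_dyadic_dvd_eq_sum_mul hQ hq₀pos (fun q₂ => T q₁ q₂)]
      refine Finset.sum_congr rfl fun q₂ _ => ?_
      split_ifs with hd
      · rfl
      · exact hT0 q₁ q₂ (Or.inr hd)
    simp_rw [e1]
    unfold qSet
    rw [Finset.sum_filter, ← sum_dyadic_dvd_eq_sum_mul hQ hq₀pos
      (fun q₁ => ∑ q' ∈ (Icc 1 ⌊2 * Q⌋₊).filter (fun q => q₀ * q ∈ dyadic Q), T q₁ (q₀ * q'))]
    refine Finset.sum_congr rfl fun q₁ _ => ?_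
    split_ifs with hd
    · rfl
    · exact Finset.sum_eq_zero fun q' _ => hT0 q₁ _ (Or.inl hd)
  rw [step1]
  -- Step 2: compare termwise in `(q, q')`
  refine Finset.sum_congr rfl fun q hq => Finset.sum_congr rfl fun q' hq' => ?_
  have hqpos : 0 < q := (qSet_bounds hQ hq₀pos hq).1
  have hq'pos : 0 < q' := (qSet_bounds hQ hq₀pos hq').1
  simp only [hT]
  by_cases hP : q.Coprime q' ∧ IsCoprime ((q₀ * q * q' * r : ℕ) : ℤ) (-a)
  · rw [if_pos hP, Finset.mul_sum]
    refine Finset.sum_congr rfl fun n₁ hn₁ => ?_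
    rw [Finset.mul_sum]
    refine Finset.sum_congr rfl fun n₂ _ => ?_
    have hn₁pos : 0 < n₁ := pos_of_mem_dyadic hN hn₁
    by_cases hC : (n₁ * q').Coprime (n₂ * q) ∧ ((q₀ * r : ℕ) : ℤ) ∣ ((n₂ : ℤ) - n₁)
    · rw [if_pos ((calR1_conds_iff hq₀pos hq₀Q hrpos hqpos hq'pos n₁ n₂).2 ⟨hP, hC⟩), if_pos hC,
        calR1_term_eq M Y β γ H hq₀pos hrpos hqpos hq'pos hP.1 hn₁pos hC.2, mul_assoc]
    · rw [if_neg (fun h => hC ((calR1_conds_iff hq₀pos hq₀Q hrpos hqpos hq'pos n₁ n₂).1 h).2),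
        if_neg hC, mul_zero]
  · rw [if_neg hP]
    refine Finset.sum_eq_zero fun n₁ _ => Finset.sum_eq_zero fun n₂ _ => ?_
    rw [if_neg (fun h => hP ((calR1_conds_iff hq₀pos hq₀Q hrpos hqpos hq'pos n₁ n₂).1 h).1)]

/-- **`ℛ₁⁺` of the Theorem-1 line is `dispR1C (−a)`** (`Q, R, N ≥ 0`). [cite: BombieriFriedlanderIwaniecActa1986, §6 (6.14) p. 221] -/
theorem calR1plus_eq_dispR1C (a : ℤ) (M Y : ℝ) {N Q R : ℝ} (hN : 0 ≤ N) (hQ : 0 ≤ Q) (hR : 0 ≤ R)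
    (Q₀ : ℝ) (β γ : ℕ → ℝ) (H : ℕ) :
    calR1plus a M Y N Q R Q₀ β γ H = dispR1C (-a) M Y N Q R Q₀ ((H : ℕ) : ℝ) β γ := by
  rw [calR1plus_eq_sum a M Y N hQ R Q₀ β γ H]
  unfold dispR1C
  exact Finset.sum_congr rfl fun q₀ hq₀ => calR1q_eq_dispR1q0 a M Y hN hQ hR β γ H hq₀

/-- **`‖ℛ₁‖ ≤ 2‖dispR1C (−a)‖`**: the remainder of (6.11) of the Theorem-1 line is controlled by
the sum bounded in `…DispersionR1SecondBound`. [cite: BombieriFriedlanderIwaniecActa1986, §6 (6.14) p. 221] -/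
theorem norm_calR1_le_two_mul_dispR1C (a : ℤ) (M Y : ℝ) {N Q R : ℝ} (hN : 0 ≤ N) (hQ : 0 ≤ Q)
    (hR : 0 ≤ R) (Q₀ : ℝ) (β γ : ℕ → ℝ) (H : ℕ) :
    ‖calR1 a M Y N Q R Q₀ β γ H‖ ≤ 2 * ‖dispR1C (-a) M Y N Q R Q₀ ((H : ℕ) : ℝ) β γ‖ := by
  rw [← calR1plus_eq_dispR1C a M Y hN hQ hR Q₀ β γ H]
  exact norm_calR1_le_two_mul a M Y N Q R Q₀ β γ H

end BFI

end Literature.NumberTheory.Sieve
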